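import Literature.GroupTheory.SpecificGroups.PGL2SubfieldCharP
import HarnessLib

/-!
# Finite subgroups of `PGL₂(k)` in characteristic `p`, V: Faber's §6.2 (`Λ = 𝔽_qˣ` ⇒
`H = PGL₂(𝔽_q)`, or `q = 3` and `|H| = 60`)

Topic `GroupTheory/SpecificGroups`; theorems plus one small definition (`IsNormalised.mult`, the
multiplier of an element as an element of `Λ`), no named facts.  Fifth part of Dickson's
classification of the finite `p`-irregular subgroups of `PGL₂(k)` following X. Faber, *Finite
`p`-irregular subgroups of `PGL₂(k)*`, arXiv:1112.1999 = La Matematica 2 (2023) [Faber2011], §6.2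
(the case `Λ = 𝔽_qˣ`, `q` odd) with §6.2.1 (`f = 1`) and the order statement of §6.2.2
(`(f, q) = (3, 3)`), using Prop. 4.7 and Lemma 6.4; after L. E. Dickson, *Linear groups* (1901),
Ch. XII [Dickson1901]; parts I–IV are `PGL2SylowCharP`, `PGL2BorelCharP`, `PGL2CountingCharP`,
`PGL2SubfieldCharP`.  Use: the input "classification of finite subgroups of `PGL₂(𝔽̄_q)`" of
Newton–Thorne, *Symmetric power functoriality, II*, Publ. IHES 134 (2021), proof of Prop. 3.7
[NewtonThorneIHES2021b].

## Setting and contents (all proved)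

`k` algebraically closed of odd characteristic `p`, `H ≤ PGL₂(k)` finite in normal form
(`IsNormalised p H`, part IV) with `|Λ(H)| = q - 1` (every unit of `𝔽_q = 𝔽_{Γ(H)}` is a
multiplier, `IsNormalised.mk0_mem_Lambda`), `n = [H : Stab_H(∞)] = 1 + fq`, `t₀ = δ_{-1} ∈ H`.

* Involutions in a coset (Faber §6.2, Lemma 3.2): `card_inv_fibre_le_one` (the trace condition is
  linear in the translation part), `card_inv_mul_le` (**at most `q - 1` involutions per coset of
  `Stab_H(∞)`**), `exists_smul_infty_eq_coe` (**two involutions in a coset make its point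
  `s • ∞` lie in `𝔽_q`**), `stabDeriv_eq_neg_one_of_sq`, `card_inv_stabilizer_le` (at most `q`
  involutions fix `∞`).
* The centraliser of `t₀` (Faber Prop. 4.7): `smul_eq_or_swap_of_commute`, `card_comm_le`
  (`≤ 2(q-1)`), `card_comm_le_of_forall` (no swap ⇒ `≤ q-1`), `swap_mul_homoth_neg_one`,
  `two_mul_card_Lambda_le_card_comm` (a swap ⇒ `≥ 2(q-1)`); `card_conj_mul_card_comm`
  (orbit–stabiliser for conjugation), `card_conj_le` (conjugates of `t₀` are involutions, at most
  `q` of them in `Stab_H(∞)`).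
* The count: `card_inv_le_sum_section`, `card_filter_two_le` (at most `q` cosets contain two
  involutions, Lemma 6.4), `card_inv_le` (**at most `(n-1) + q(q-2)` involutions off the
  stabiliser**), `exists_swap` (**some element of `H` swaps `0` and `∞`**, Faber: "we conclude
  that `t₀` is normalized by the dihedral group `D`"), `two_mul_card_conj_eq` (`2·#conj(t₀) = qn`),
  `eq_one_or_of_odd_of_le` (the inequality `f ≤ 2 + 1/(q-2)` with `f` odd), **`index_eq_or`:
  `n = q + 1`, or `n = 10` and `q = 3`**.
* `f = 1` (§6.2.1): `conj_swap_smul_infty` (`v_μ • ∞ = μ`), `exists_eq_conj_swap_mul` (the `v_μ`,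
  `μ ∈ 𝔽_q`, represent all non-trivial cosets, so every element moves `∞` into `ℙ¹(𝔽_q)`),
  `exists_eq_antidiag_of_index_eq` (the swap is `w_b` with `b ∈ 𝔽_q`),
  `conj_antidiag_mem_pglTwo`, `le_pglTwo_of_index_eq`, **`eq_pglTwo`: `H = PGL₂(𝔽_q)`**
  (with `card_pglTwo` of part IV); `card_eq_sixty` and the summary **`eq_pglTwo_or_card_eq_sixty`:
  `H = PGL₂(𝔽_q)`, or `q = 3` and `|H| = 60`**.

The rationality step of §6.2.1 is done slightly differently from the source: since the `q`
conjugates `v_μ = τ_μ w τ_{-μ}` already represent all non-trivial cosets and have the rational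
lifts `(μ, b - μ²; 1, -μ)` once `b = (w τ_1 w) • ∞ ∈ 𝔽_q`, no further computation of the
entries `β_i` is needed.

## What is NOT here

The identification of the order-`60` group with `𝔄₅` (§6.2.2, Lemma 4.20), §6.1.1 for `q = 3`,
the `p = 2` cases (§6.1.2–6.1.3) and the assembled classification / Newton–Thorne corollary: later
parts.

## References

* [Faber2011] X. Faber, *Finite p-irregular subgroups of PGL₂(k)*, arXiv:1112.1999 (2011); La
  Matematica 2 (2023) 479–522 — Lemma 3.2, Prop. 4.7, Lemma 6.4, §6.2, §6.2.1, §6.2.2 (read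
  2026-08-15, chunks p0009, p0017–p0019).
* [Dickson1901] L. E. Dickson, *Linear groups with an exposition of the Galois field theory*,
  Teubner (1901), Ch. XII §§257–259.
* [NewtonThorneIHES2021b] J. Newton, J. A. Thorne, *Symmetric power functoriality for
  holomorphic modular forms, II*, Publ. Math. IHÉS 134 (2021), proof of Prop. 3.7.
-/

open scoped MatrixGroups OnePoint Pointwise
open Matrix MulAction

namespace Literature.GroupTheory.SpecificGroups.PGL2

open Literature.NumberTheory.GaloisRepresentations

variable {k : Type*} [Field k]

local notation "M₂" => Matrix (Fin 2) (Fin 2) k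


section CaseAll

variable [DecidableEq k] (p : ℕ) [Fact p.Prime] [CharP k p]
variable {H : Subgroup PGL(Fin 2, k)} [Finite H]

omit [DecidableEq k] in
/-- In odd characteristic `-1 ≠ 1` in `kˣ`. [folklore] -/
theorem neg_one_ne_one_of_ne_two (hp : p ≠ 2) : (-1 : kˣ) ≠ 1 := by
  intro h
  have h2 : (2 : k) = 0 := by
    have := congrArg (fun u : kˣ => (u : k)) h
    simp only [Units.val_neg, Units.val_one] at this
    linear_combination -this
  have := (CharP.cast_eq_zero_iff k p 2).mp (by exact_mod_cast h2)
  exact hp ((Nat.prime_dvd_prime_iff_eq (Fact.out : p.Prime) Nat.prime_two).mp this)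

omit [DecidableEq k] in
/-- `t₀ = δ_{-1}` is an involution. [folklore] -/
theorem homoth_neg_one_mul_self : homoth (-1 : kˣ) * homoth (-1 : kˣ) = (1 : PGL(Fin 2, k)) := by
  rw [← map_mul, neg_one_mul, neg_neg, map_one]

namespace IsNormalised

variable {p} (hN : IsNormalised p H)
include hN

/-- **If `d = q - 1` then every unit of `𝔽_q` is a multiplier** (`Λ ↪ 𝔽_qˣ` is onto; Faber 2011,
Lemma 6.3: "`Λ = 𝔽_qˣ`"). [cite: Faber2011, Lemma 6.3, §6.2] -/
theorem mk0_mem_Lambda [IsAlgClosed k] (hd : Nat.card (Lambda H) = Nat.card (Gamma H) - 1)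
    {η : k} (hη : η ∈ stabField (Gamma H)) (h0 : η ≠ 0) : Units.mk0 η h0 ∈ Lambda H := by
  haveI := hN.finite_stabField
  haveI : Finite (Lambda H) := Finite.of_surjective _ (stabDeriv H).rangeRestrict_surjective
  have hbij : Function.Bijective (lambdaToUnits H) := by
    refine (Nat.bijective_iff_injective_and_card _).mpr ⟨lambdaToUnits_injective H, ?_⟩
    rw [Nat.card_units, hN.card_stabField, hd]
  obtain ⟨a, ha⟩ := hbij.2 (Units.mk0 ⟨η, hη⟩ (fun h => h0 (congrArg Subtype.val h)))
  have : (a : kˣ) = Units.mk0 η h0 := by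
    apply Units.ext
    have := congrArg (fun u : (stabField (Gamma H))ˣ => ((u : stabField (Gamma H)) : k)) ha
    simpa using this
  rw [← this]
  exact a.2

/-- Homotheties by units of `𝔽_q` lie in `H` when `d = q - 1`. [cite: Faber2011, §6.2] -/
theorem homoth_mk0_mem [IsAlgClosed k] (hd : Nat.card (Lambda H) = Nat.card (Gamma H) - 1)
    {η : k} (hη : η ∈ stabField (Gamma H)) (h0 : η ≠ 0) : homoth (Units.mk0 η h0) ∈ H :=
  hN.homoth_mem _ (hN.mk0_mem_Lambda hd hη h0)

/-- `t₀ = δ_{-1} ∈ H` when `d = q - 1` (Faber 2011, §6.2: "Let `t₀ = (-1 0; 0 1) ∈ G`").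
[cite: Faber2011, §6.2] -/
theorem homoth_neg_one_mem [IsAlgClosed k] (hd : Nat.card (Lambda H) = Nat.card (Gamma H) - 1) :
    homoth (-1 : kˣ) ∈ H := by
  have h1 : ((-1 : k)) ∈ stabField (Gamma H) := neg_mem (stabField (Gamma H)).one_mem
  have : (-1 : kˣ) = Units.mk0 (-1 : k) (neg_ne_zero.mpr one_ne_zero) := Units.ext rfl
  rw [this]
  exact hN.homoth_mk0_mem hd h1 _

/-! #### Involutions in a coset of `Stab_H(∞)` -/

omit [Fact (Nat.Prime p)] [CharP k p] hN in
/-- **At most one involution per multiplier in a coset**: for `s` not fixing `∞` and a multiplier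
`l`, at most one `n ∈ Stab_H(∞)` with `n'(∞) = l` makes `s n` an involution — the trace condition
is linear in the translation part (Faber 2011, §6.2: "given `s_i` and `λ`, there is at most one
`μ ∈ 𝔽_q` such that `s_i t_{λ,μ}` has order `2`"). [cite: Faber2011, §6.2] -/
theorem card_inv_fibre_le_one {s : PGL(Fin 2, k)} (hs : s • (∞ : OnePoint k) ≠ ∞) (l : kˣ) :
    Nat.card {n : stabilizer H (∞ : OnePoint k) //
      (stabDeriv H n : kˣ) = l ∧ (s * ((n : H) : PGL(Fin 2, k))) ^ 2 = 1} ≤ 1 := by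
  obtain ⟨g, rfl⟩ := Matrix.ProjGenLinGroup.mk_surjective s
  have hg : g 1 0 ≠ 0 := by rwa [Ne, mk_smul_infty_eq_self_iff] at hs
  -- the shift of such an `n` is determined: `g₀₀ l + g₁₀ μ + g₁₁ = 0`
  have hμ : ∀ n : stabilizer H (∞ : OnePoint k), (stabDeriv H n : kˣ) = l →
      (Matrix.ProjGenLinGroup.mk g * ((n : H) : PGL(Fin 2, k))) ^ 2 = 1 →
      shiftInfty ((n : H) : PGL(Fin 2, k)) = -(g 0 0 * l + g 1 1) / g 1 0 := by
    intro n hl hsq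
    have hne : Matrix.ProjGenLinGroup.mk g * ((n : H) : PGL(Fin 2, k)) ≠ 1 := by
      intro h1
      apply hs
      have := congrArg (· • (∞ : OnePoint k)) h1
      simp only [mul_smul, coe_stabilizer_smul_infty H n, one_smul] at this
      exact this
    rw [coe_stabilizer_eq_transl_mul_homoth n, hl, ← mul_assoc, transl_apply, homoth_apply,
      ← map_mul, ← map_mul] at hsq hne
    rw [mk_sq_eq_one_iff_trace_eq_zero hne, trace_mul_upperRightHom_mul_diagGL] at hsq
    rw [eq_div_iff hg]
    linear_combination hsq
  refine (Finite.card_le_one_iff_subsingleton).mpr ⟨fun n n' => Subtype.ext ?_⟩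
  obtain ⟨n, hl, hsq⟩ := n
  obtain ⟨n', hl', hsq'⟩ := n'
  apply Subtype.ext
  apply Subtype.ext
  refine eq_of_derivInfty_eq_of_shiftInfty_eq (coe_stabilizer_smul_infty H n)
    (coe_stabilizer_smul_infty H n') ?_ ((hμ n hl hsq).trans (hμ n' hl' hsq').symm)
  have := congrArg (fun u : kˣ => (u : k)) (hl.trans hl'.symm)
  simpa using this

omit [Fact (Nat.Prime p)] [CharP k p] hN in
/-- **At most `q - 1` involutions in a coset of `Stab_H(∞)`**: `n ↦ n'(∞) ∈ Λ` is injective on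
the `n` making `s n` an involution (Faber 2011, §6.2: "`fq² ≤ |{s ∈ G ∖ N : s² = I}| ≤ fq(q-1)`").
[cite: Faber2011, §6.2] -/
theorem card_inv_mul_le {s : PGL(Fin 2, k)} (hs : s • (∞ : OnePoint k) ≠ ∞) :
    Nat.card {n : stabilizer H (∞ : OnePoint k) // (s * ((n : H) : PGL(Fin 2, k))) ^ 2 = 1} ≤
      Nat.card (Lambda H) := by
  haveI : Finite (Lambda H) := Finite.of_surjective _ (stabDeriv H).rangeRestrict_surjective
  refine Nat.card_le_card_of_injective
    (fun n : {n : stabilizer H (∞ : OnePoint k) // (s * ((n : H) : PGL(Fin 2, k))) ^ 2 = 1} =>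
      (⟨stabDeriv H n.1, ⟨n.1, rfl⟩⟩ : Lambda H)) ?_
  intro n n' hnn'
  have hl : (stabDeriv H n.1 : kˣ) = stabDeriv H n'.1 := congrArg Subtype.val hnn'
  have hsub := card_inv_fibre_le_one (H := H) hs (stabDeriv H n'.1 : kˣ)
  rw [Finite.card_le_one_iff_subsingleton] at hsub
  have h3 : (⟨n.1, hl, n.2⟩ : {m : stabilizer H (∞ : OnePoint k) //
      (stabDeriv H m : kˣ) = stabDeriv H n'.1 ∧ (s * ((m : H) : PGL(Fin 2, k))) ^ 2 = 1}) =
      ⟨n'.1, rfl, n'.2⟩ := hsub.elim _ _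
  have h2 := congrArg Subtype.val h3
  exact Subtype.ext h2

/-- **Two involutions in one coset make its point rational**: if `s n₁`, `s n₂` are involutions
for distinct `n₁, n₂ ∈ Stab_H(∞)`, then `s • ∞ ∈ 𝔽_q` (Faber 2011, §6.2: "Hence
`α_i = μ/(1 - λ) ∈ 𝔽_q`"). [cite: Faber2011, §6.2] -/
theorem exists_smul_infty_eq_coe [IsAlgClosed k] {s : PGL(Fin 2, k)} (hs : s • (∞ : OnePoint k) ≠ ∞)
    {n₁ n₂ : stabilizer H (∞ : OnePoint k)} (hne : n₁ ≠ n₂)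
    (h₁ : (s * ((n₁ : H) : PGL(Fin 2, k))) ^ 2 = 1) (h₂ : (s * ((n₂ : H) : PGL(Fin 2, k))) ^ 2 = 1) :
    ∃ x ∈ stabField (Gamma H), s • (∞ : OnePoint k) = x := by
  -- `s' = s n₁` is an involution and `s' n = s n₂` with `n = n₁⁻¹ n₂ ≠ 1`
  set n : stabilizer H (∞ : OnePoint k) := n₁⁻¹ * n₂ with hndef
  have hn1 : n ≠ 1 := by
    intro h
    apply hne
    rw [hndef, inv_mul_eq_one] at h
    exact h
  set s' := s * ((n₁ : H) : PGL(Fin 2, k)) with hs'def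
  have hs'n : s' * ((n : H) : PGL(Fin 2, k)) = s * ((n₂ : H) : PGL(Fin 2, k)) := by
    rw [hs'def, hndef, Subgroup.coe_mul, Subgroup.coe_mul, Subgroup.coe_inv, Subgroup.coe_inv]
    group
  have hs'i : s' • (∞ : OnePoint k) = s • ∞ := by
    rw [hs'def, mul_smul, coe_stabilizer_smul_infty H n₁]
  obtain ⟨g, hg⟩ := Matrix.ProjGenLinGroup.mk_surjective s'
  have hγ : g 1 0 ≠ 0 := by
    intro h0
    apply hs
    rw [← hs'i, ← hg, mk_smul_infty_eq_self_iff]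
    exact h0
  have hs'1 : s' ≠ 1 := by
    intro h1; apply hs; rw [← hs'i, h1, one_smul]
  -- trace conditions: `tr g = 0` and `g₀₀ l + g₁₀ μ + g₁₁ = 0` for `n = τ_μ δ_l`
  have htr : (g : M₂).trace = 0 := by
    rw [← mk_sq_eq_one_iff_trace_eq_zero (by rw [hg]; exact hs'1), hg]
    exact h₁
  have hdec := coe_stabilizer_eq_transl_mul_homoth n
  set l : kˣ := (stabDeriv H n : kˣ) with hl
  set μ := shiftInfty ((n : H) : PGL(Fin 2, k)) with hμ
  have hsq : (Matrix.ProjGenLinGroup.mk g * transl μ * homoth l) ^ 2 = 1 := by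
    rw [hg, mul_assoc, ← hdec, hs'n]
    exact h₂
  have hne1 : Matrix.ProjGenLinGroup.mk g * transl μ * homoth l ≠ 1 := by
    rw [hg, mul_assoc, ← hdec, hs'n]
    intro h1
    apply hs
    have := congrArg (· • (∞ : OnePoint k)) h1
    simp only [mul_smul, coe_stabilizer_smul_infty H n₂, one_smul] at this
    exact this
  rw [transl_apply, homoth_apply, ← map_mul, ← map_mul] at hsq hne1
  rw [mk_sq_eq_one_iff_trace_eq_zero hne1, trace_mul_upperRightHom_mul_diagGL] at hsq
  rw [Matrix.trace_fin_two] at htr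
  -- `l ≠ 1`: otherwise `μ = 0` and `n = 1`
  have hl1 : (l : k) ≠ 1 := by
    intro hl1
    have hμ0 : μ = 0 := by
      have : g 1 0 * μ = 0 := by
        have h' : g 0 0 * (l : k) + g 1 0 * μ + g 1 1 = 0 := hsq
        rw [hl1, mul_one] at h'
        have h'' : (g : M₂) 0 0 + (g : M₂) 1 1 = 0 := htr
        linear_combination h' - h''
      exact (mul_eq_zero.mp this).resolve_left hγ
    apply hn1
    apply Subtype.ext; apply Subtype.ext
    rw [hdec, hμ0, AddChar.map_zero_eq_one, one_mul, show l = 1 from Units.ext hl1, map_one]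
    rfl
  -- `s • ∞ = g₀₀/g₁₀ = μ/(1 - l) ∈ 𝔽_q`
  have hμF : μ ∈ stabField (Gamma H) := hN.shiftInfty_mem n
  have hlF : (l : k) ∈ stabField (Gamma H) := coe_mem_stabField_of_mem_Lambda ⟨n, rfl⟩
  refine ⟨μ / (1 - l), div_mem hμF (sub_mem (stabField (Gamma H)).one_mem hlF), ?_⟩
  rw [← hs'i, ← hg, mk_smul, OnePoint.smul_infty_eq_ite, if_neg hγ, OnePoint.coe_eq_coe,
    div_eq_div_iff hγ (sub_ne_zero.mpr (Ne.symm hl1))]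
  have h' : g 0 0 * (l : k) + g 1 0 * μ + g 1 1 = 0 := hsq
  have h'' : (g : M₂) 0 0 + (g : M₂) 1 1 = 0 := htr
  linear_combination -h' + h''

/-! #### The involution `t₀ = δ_{-1}` and its centraliser -/

omit [Finite H] hN in
/-- An element commuting with `t₀ = δ_{-1}` (`p` odd) fixes both `∞, 0` or swaps them
(Faber 2011, Prop. 4.7 / §6.2). [cite: Faber2011, Prop. 4.7] -/
theorem smul_eq_or_swap_of_commute (hp : p ≠ 2) {g : PGL(Fin 2, k)}
    (hg : g * homoth (-1 : kˣ) = homoth (-1 : kˣ) * g) :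
    (g • (∞ : OnePoint k) = ∞ ∧ g • ((0 : k) : OnePoint k) = ((0 : k) : OnePoint k)) ∨
      (g • (∞ : OnePoint k) = ((0 : k) : OnePoint k) ∧ g • ((0 : k) : OnePoint k) = ∞) := by
  have hne : (-1 : kˣ) ≠ 1 := neg_one_ne_one_of_ne_two p hp
  have h1 := smul_infty_mem_of_commute_homoth hne hg ∞ (Or.inl rfl)
  have h2 := smul_infty_mem_of_commute_homoth hne hg ((0 : k) : OnePoint k) (Or.inr rfl)
  have hinj : g • (∞ : OnePoint k) ≠ g • ((0 : k) : OnePoint k) :=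
    fun h => OnePoint.infty_ne_coe 0 (smul_left_cancel g h)
  rcases h1 with h1 | h1 <;> rcases h2 with h2 | h2
  · exact absurd (h1.trans h2.symm) hinj
  · exact Or.inl ⟨h1, h2⟩
  · exact Or.inr ⟨h1, h2⟩
  · exact absurd (h1.trans h2.symm) hinj

omit [Fact (Nat.Prime p)] [CharP k p] [Finite H] hN in
/-- An element of `H` fixing `∞` and `0` is the homothety of its multiplier. [folklore] -/
theorem coe_eq_homoth_of_smul {g : H} (hi : (g : PGL(Fin 2, k)) • (∞ : OnePoint k) = ∞)
    (h0 : (g : PGL(Fin 2, k)) • ((0 : k) : OnePoint k) = ((0 : k) : OnePoint k)) :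
    (g : PGL(Fin 2, k)) =
      homoth (stabDeriv H ⟨g, by rw [mem_stabilizer_iff, Subgroup.smul_def]; exact hi⟩ : kˣ) := by
  obtain ⟨a, ha, hga⟩ := exists_eq_homoth_of_smul_infty_of_smul_zero hi h0
  calc (g : PGL(Fin 2, k)) = homoth a := hga
    _ = _ := by
        congr 1
        exact Units.ext ha

open scoped Classical in
/-- The multiplier of an element of `H` fixing `∞` (junk `1` otherwise). [folklore] -/
noncomputable def mult (g : H) : Lambda H :=
  if hg : (g : PGL(Fin 2, k)) • (∞ : OnePoint k) = ∞ then
    ⟨stabDeriv H ⟨g, by rw [mem_stabilizer_iff, Subgroup.smul_def]; exact hg⟩, ⟨_, rfl⟩⟩ else 1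

omit [Fact (Nat.Prime p)] [CharP k p] [Finite H] hN in
/-- An element of `H` fixing `∞` and `0` is `δ_{mult g}`. [folklore] -/
theorem coe_eq_homoth_mult {g : H} (hi : (g : PGL(Fin 2, k)) • (∞ : OnePoint k) = ∞)
    (h0 : (g : PGL(Fin 2, k)) • ((0 : k) : OnePoint k) = ((0 : k) : OnePoint k)) :
    (g : PGL(Fin 2, k)) = homoth ((mult g : Lambda H) : kˣ) := by
  rw [mult, dif_pos hi]
  exact coe_eq_homoth_of_smul hi h0

omit [Finite H] hN in
/-- If `w` swaps `∞, 0` and `g` swaps `∞, 0` then `w⁻¹ g` fixes both. [folklore] -/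
theorem inv_mul_smul_of_swap {w g : PGL(Fin 2, k)}
    (hw : w • (∞ : OnePoint k) = ((0 : k) : OnePoint k) ∧ w • ((0 : k) : OnePoint k) = ∞)
    (hg : g • (∞ : OnePoint k) = ((0 : k) : OnePoint k) ∧ g • ((0 : k) : OnePoint k) = ∞) :
    (w⁻¹ * g) • (∞ : OnePoint k) = ∞ ∧ (w⁻¹ * g) • ((0 : k) : OnePoint k) = ((0 : k) : OnePoint k) := by
  constructor
  · rw [mul_smul, hg.1, inv_smul_eq_iff]
    exact hw.1.symm
  · rw [mul_smul, hg.2, inv_smul_eq_iff]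
    exact hw.2.symm

omit hN in
/-- **The centraliser of `t₀` has at most `2(q-1)` elements** — those fixing `∞, 0` are the
homotheties `δ_a`, `a ∈ Λ`, and those swapping them are `w₀ δ_a` for one swap `w₀`
(Faber 2011, Prop. 4.7 and §6.2: `C_G(t₀) ⊆ N_G(⟨t₀⟩) = H` or the dihedral `D`, `|D| = 2|H|`).
[cite: Faber2011, Prop. 4.7, §6.2] -/
theorem card_comm_le (hp : p ≠ 2) :
    Nat.card {g : H // (g : PGL(Fin 2, k)) * homoth (-1 : kˣ) = homoth (-1 : kˣ) * g} ≤
      2 * Nat.card (Lambda H) := by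
  classical
  haveI : Finite (Lambda H) := Finite.of_surjective _ (stabDeriv H).rangeRestrict_surjective
  by_cases hsw : ∃ w : {g : H // (g : PGL(Fin 2, k)) * homoth (-1 : kˣ) = homoth (-1 : kˣ) * g},
      ((w : H) : PGL(Fin 2, k)) • (∞ : OnePoint k) ≠ ∞
  · obtain ⟨w₀, hw₀⟩ := hsw
    have hw₀' := (smul_eq_or_swap_of_commute hp w₀.2).resolve_left (fun h => hw₀ h.1)
    let f : {g : H // (g : PGL(Fin 2, k)) * homoth (-1 : kˣ) = homoth (-1 : kˣ) * g} →
        Lambda H ⊕ Lambda H := fun g =>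
      if (g.1 : PGL(Fin 2, k)) • (∞ : OnePoint k) = ∞ then Sum.inl (mult g.1)
      else Sum.inr (mult ((w₀ : H)⁻¹ * g.1))
    have hf : Function.Injective f := by
      intro g g' hgg'
      rcases smul_eq_or_swap_of_commute hp g.2 with hg | hg <;>
        rcases smul_eq_or_swap_of_commute hp g'.2 with hg' | hg'
      · simp only [f, if_pos hg.1, if_pos hg'.1, Sum.inl.injEq] at hgg'
        apply Subtype.ext; apply Subtype.ext
        rw [coe_eq_homoth_mult hg.1 hg.2, coe_eq_homoth_mult hg'.1 hg'.2, hgg']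
      · have hne : ¬ ((g'.1 : H) : PGL(Fin 2, k)) • (∞ : OnePoint k) = ∞ :=
          fun h => OnePoint.infty_ne_coe 0 (h.symm.trans hg'.1)
        simp only [f, if_pos hg.1, if_neg hne] at hgg'
        exact absurd hgg' Sum.inl_ne_inr
      · have hne : ¬ ((g.1 : H) : PGL(Fin 2, k)) • (∞ : OnePoint k) = ∞ :=
          fun h => OnePoint.infty_ne_coe 0 (h.symm.trans hg.1)
        simp only [f, if_neg hne, if_pos hg'.1] at hgg'
        exact absurd hgg' Sum.inr_ne_inl
      · have hne : ¬ ((g.1 : H) : PGL(Fin 2, k)) • (∞ : OnePoint k) = ∞ :=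
          fun h => OnePoint.infty_ne_coe 0 (h.symm.trans hg.1)
        have hne' : ¬ ((g'.1 : H) : PGL(Fin 2, k)) • (∞ : OnePoint k) = ∞ :=
          fun h => OnePoint.infty_ne_coe 0 (h.symm.trans hg'.1)
        simp only [f, if_neg hne, if_neg hne', Sum.inr.injEq] at hgg'
        have h1 := inv_mul_smul_of_swap hw₀' hg
        have h2 := inv_mul_smul_of_swap hw₀' hg'
        rw [← Subgroup.coe_inv, ← Subgroup.coe_mul] at h1 h2
        have := (coe_eq_homoth_mult h1.1 h1.2).trans ((congrArg (fun u : Lambda H => homoth (u : kˣ)) hgg').trans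
          (coe_eq_homoth_mult h2.1 h2.2).symm)
        rw [Subgroup.coe_mul, Subgroup.coe_mul] at this
        apply Subtype.ext; apply Subtype.ext
        exact mul_left_cancel this
    calc Nat.card _ ≤ Nat.card (Lambda H ⊕ Lambda H) := Nat.card_le_card_of_injective f hf
      _ = 2 * Nat.card (Lambda H) := by rw [Nat.card_sum]; ring
  · push Not at hsw
    let f : {g : H // (g : PGL(Fin 2, k)) * homoth (-1 : kˣ) = homoth (-1 : kˣ) * g} → Lambda H :=
      fun g => mult g.1
    have hf : Function.Injective f := by
      intro g g' hgg'
      have hg := (smul_eq_or_swap_of_commute hp g.2).resolve_right (fun h => by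
        have := hsw g; rw [h.1] at this; exact OnePoint.coe_ne_infty 0 this)
      have hg' := (smul_eq_or_swap_of_commute hp g'.2).resolve_right (fun h => by
        have := hsw g'; rw [h.1] at this; exact OnePoint.coe_ne_infty 0 this)
      apply Subtype.ext; apply Subtype.ext
      rw [coe_eq_homoth_mult hg.1 hg.2, coe_eq_homoth_mult hg'.1 hg'.2]
      exact congrArg (fun u : Lambda H => homoth (u : kˣ)) hgg'
    calc Nat.card _ ≤ Nat.card (Lambda H) := Nat.card_le_card_of_injective f hf
      _ ≤ 2 * Nat.card (Lambda H) := by omega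

omit hN in
/-- **Without a swap the centraliser of `t₀` has at most `q - 1` elements** (they all fix `∞, 0`
and are homotheties). [cite: Faber2011, Prop. 4.7, §6.2] -/
theorem card_comm_le_of_forall (hp : p ≠ 2)
    (hsw : ∀ w : H, ¬ ((w : PGL(Fin 2, k)) • (∞ : OnePoint k) = ((0 : k) : OnePoint k) ∧
      (w : PGL(Fin 2, k)) • ((0 : k) : OnePoint k) = ∞)) :
    Nat.card {g : H // (g : PGL(Fin 2, k)) * homoth (-1 : kˣ) = homoth (-1 : kˣ) * g} ≤
      Nat.card (Lambda H) := by
  classical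
  haveI : Finite (Lambda H) := Finite.of_surjective _ (stabDeriv H).rangeRestrict_surjective
  let f : {g : H // (g : PGL(Fin 2, k)) * homoth (-1 : kˣ) = homoth (-1 : kˣ) * g} → Lambda H :=
    fun g => mult g.1
  have hf : Function.Injective f := by
    intro g g' hgg'
    have hg := (smul_eq_or_swap_of_commute hp g.2).resolve_right (hsw g.1)
    have hg' := (smul_eq_or_swap_of_commute hp g'.2).resolve_right (hsw g'.1)
    apply Subtype.ext; apply Subtype.ext
    rw [coe_eq_homoth_mult hg.1 hg.2, coe_eq_homoth_mult hg'.1 hg'.2]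
    exact congrArg (fun u : Lambda H => homoth (u : kˣ)) hgg'
  exact Nat.card_le_card_of_injective f hf

/-! #### Counting the conjugates of `t₀` -/

omit [DecidableEq k] [Fact (Nat.Prime p)] [CharP k p] [Finite H] hN in
/-- **Orbit–stabiliser for conjugation**: the number of conjugates of `t` times the order of its
centraliser is `|H|` (Faber 2011, §6.2: "the orbit-stabilizer theorem shows that there are
`|G|/|H|` elements conjugate to `t₀`"). [cite: Faber2011, §6.2] -/
theorem card_conj_mul_card_comm (t : H) :
    Nat.card {h : H // ∃ g : H, g * t * g⁻¹ = h} * Nat.card {g : H // g * t = t * g} = Nat.card H := by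
  classical
  have h1 := Subgroup.card_mul_index (MulAction.stabilizer (ConjAct H) t)
  rw [MulAction.index_stabilizer, ← Nat.card_coe_set_eq] at h1
  have h2 : Nat.card (ConjAct H) = Nat.card H := Nat.card_congr ConjAct.ofConjAct.toEquiv
  rw [h2] at h1
  have h3 : Nat.card (MulAction.stabilizer (ConjAct H) t) = Nat.card {g : H // g * t = t * g} := by
    refine Nat.card_congr (Equiv.subtypeEquiv ConjAct.ofConjAct.toEquiv (fun g => ?_))
    rw [MulAction.mem_stabilizer_iff, ConjAct.smul_def, mul_inv_eq_iff_eq_mul]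
    rfl
  have h4 : Nat.card (MulAction.orbit (ConjAct H) t) = Nat.card {h : H // ∃ g : H, g * t * g⁻¹ = h} := by
    refine Nat.card_congr (Equiv.subtypeEquivRight (fun h => ?_))
    rw [MulAction.mem_orbit_iff]
    constructor
    · rintro ⟨g, rfl⟩
      exact ⟨ConjAct.ofConjAct g, by rw [ConjAct.smul_def]⟩
    · rintro ⟨g, hg⟩
      exact ⟨ConjAct.toConjAct g, by rw [ConjAct.smul_def, ConjAct.ofConjAct_toConjAct, hg]⟩
  rw [h3, h4, mul_comm] at h1
  exact h1

omit [Finite H] hN in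
/-- An involution of `H` fixing `∞` has multiplier `-1` (`p` odd): `(τ_β δ_a)² = τ_{β+aβ} δ_{a²}`.
[cite: Faber2011, §6.2] -/
theorem stabDeriv_eq_neg_one_of_sq (hp : p ≠ 2) (n : stabilizer H (∞ : OnePoint k))
    (hsq : ((n : H) : PGL(Fin 2, k)) ^ 2 = 1) (h1 : ((n : H) : PGL(Fin 2, k)) ≠ 1) :
    (stabDeriv H n : kˣ) = -1 := by
  have hdec := coe_stabilizer_eq_transl_mul_homoth n
  set a : kˣ := (stabDeriv H n : kˣ) with ha
  set β := shiftInfty ((n : H) : PGL(Fin 2, k)) with hβ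
  rw [hdec, pow_two, transl_mul_homoth_mul] at hsq
  have hsq' : transl (β + ↑a * β) * homoth (a * a) = transl 0 * homoth 1 := by
    rw [hsq, AddChar.map_zero_eq_one, map_one, one_mul]
  obtain ⟨hβ0, haa⟩ := transl_mul_homoth_eq_iff.mp hsq'
  have haa' : (a : k) * a = 1 := by
    have := congrArg (fun u : kˣ => (u : k)) haa
    simpa using this
  rcases mul_self_eq_one_iff.mp haa' with h | h
  · exfalso
    apply h1
    have ha1 : a = 1 := Units.ext h
    have h2 : (2 : k) ≠ 0 := by
      intro h2
      have := (CharP.cast_eq_zero_iff k p 2).mp (by exact_mod_cast h2)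
      exact hp ((Nat.prime_dvd_prime_iff_eq (Fact.out : p.Prime) Nat.prime_two).mp this)
    have hb : β = 0 := by
      rw [ha1, Units.val_one, one_mul, ← two_mul] at hβ0
      exact (mul_eq_zero.mp hβ0).resolve_left h2
    rw [hdec, hb, ha1, AddChar.map_zero_eq_one, map_one, one_mul]
  · exact Units.ext h

/-- **At most `q` involutions fix `∞`** (they are the `τ_β δ_{-1}`, `β ∈ 𝔽_q`; Faber 2011, §6.2:
"the elements conjugate to `t₀` in `N` … so that there are `q` of them in `N`").
[cite: Faber2011, §6.2] -/
theorem card_inv_stabilizer_le [IsAlgClosed k] (hp : p ≠ 2) :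
    Nat.card {n : stabilizer H (∞ : OnePoint k) //
      ((n : H) : PGL(Fin 2, k)) ^ 2 = 1 ∧ ((n : H) : PGL(Fin 2, k)) ≠ 1} ≤ Nat.card (Gamma H) := by
  haveI := hN.finite_stabField
  rw [← hN.card_stabField]
  refine Nat.card_le_card_of_injective (fun n => (⟨shiftInfty ((n.1 : H) : PGL(Fin 2, k)),
    hN.shiftInfty_mem n.1⟩ : stabField (Gamma H))) ?_
  intro n n' hnn'
  have hs : shiftInfty ((n.1 : H) : PGL(Fin 2, k)) = shiftInfty ((n'.1 : H) : PGL(Fin 2, k)) :=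
    congrArg Subtype.val hnn'
  have hd : derivInfty ((n.1 : H) : PGL(Fin 2, k)) = derivInfty ((n'.1 : H) : PGL(Fin 2, k)) := by
    have h1 := stabDeriv_eq_neg_one_of_sq hp n.1 n.2.1 n.2.2
    have h2 := stabDeriv_eq_neg_one_of_sq hp n'.1 n'.2.1 n'.2.2
    have := congrArg (fun u : kˣ => (u : k)) (h1.trans h2.symm)
    simpa using this
  apply Subtype.ext; apply Subtype.ext; apply Subtype.ext
  exact eq_of_derivInfty_eq_of_shiftInfty_eq (coe_stabilizer_smul_infty H n.1)
    (coe_stabilizer_smul_infty H n'.1) hd hs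

/-- **Conjugates of `t₀` are involutions, at most `q` of which fix `∞`**: the number of
conjugates of `t₀` is at most `|{involutions of H not fixing ∞}| + q` (Faber 2011, §6.2:
"`|{s ∈ G ∖ N : s² = I}| ≥ q(1+fq) - q = fq²`"). [cite: Faber2011, §6.2] -/
theorem card_conj_le [IsAlgClosed k] (hp : p ≠ 2) (hd : Nat.card (Lambda H) = Nat.card (Gamma H) - 1) :
    Nat.card {h : H // ∃ g : H, g * ⟨homoth (-1 : kˣ), hN.homoth_neg_one_mem hd⟩ * g⁻¹ = h} ≤
      Nat.card {h : H // (h : PGL(Fin 2, k)) • (∞ : OnePoint k) ≠ ∞ ∧ (h : PGL(Fin 2, k)) ^ 2 = 1} +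
        Nat.card (Gamma H) := by
  classical
  set t : H := ⟨homoth (-1 : kˣ), hN.homoth_neg_one_mem hd⟩ with ht
  have ht1 : (t : PGL(Fin 2, k)) ≠ 1 := by
    rw [ht, ← map_one homoth]
    exact fun h => neg_one_ne_one_of_ne_two p hp (homoth_injective h)
  have ht2 : (t : PGL(Fin 2, k)) * t = 1 := homoth_neg_one_mul_self
  -- every conjugate is a non-identity involution
  have hconj : ∀ h : H, (∃ g : H, g * t * g⁻¹ = h) →
      (h : PGL(Fin 2, k)) ^ 2 = 1 ∧ (h : PGL(Fin 2, k)) ≠ 1 := by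
    rintro h ⟨g, rfl⟩
    constructor
    · rw [Subgroup.coe_mul, Subgroup.coe_mul, Subgroup.coe_inv, pow_two]
      calc (g : PGL(Fin 2, k)) * t * (g : PGL(Fin 2, k))⁻¹ * ((g : PGL(Fin 2, k)) * t * (g : PGL(Fin 2, k))⁻¹)
          = (g : PGL(Fin 2, k)) * ((t : PGL(Fin 2, k)) * t) * (g : PGL(Fin 2, k))⁻¹ := by group
        _ = 1 := by rw [ht2, mul_one, mul_inv_cancel]
    · intro h1
      apply ht1
      rw [Subgroup.coe_mul, Subgroup.coe_mul, Subgroup.coe_inv] at h1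
      have : (t : PGL(Fin 2, k)) = (g : PGL(Fin 2, k))⁻¹ * 1 * g := by rw [← h1]; group
      rw [this]; group
  -- split according to whether the conjugate fixes `∞`
  let f : {h : H // ∃ g : H, g * t * g⁻¹ = h} →
      {h : H // (h : PGL(Fin 2, k)) • (∞ : OnePoint k) ≠ ∞ ∧ (h : PGL(Fin 2, k)) ^ 2 = 1} ⊕
        {n : stabilizer H (∞ : OnePoint k) //
          ((n : H) : PGL(Fin 2, k)) ^ 2 = 1 ∧ ((n : H) : PGL(Fin 2, k)) ≠ 1} := fun h =>
    if hi : (h.1 : PGL(Fin 2, k)) • (∞ : OnePoint k) = ∞ then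
      Sum.inr ⟨⟨h.1, by rw [mem_stabilizer_iff, Subgroup.smul_def]; exact hi⟩, hconj h.1 h.2⟩
    else Sum.inl ⟨h.1, hi, (hconj h.1 h.2).1⟩
  have hf : Function.Injective f := by
    intro h h' hhh'
    by_cases hi : (h.1 : PGL(Fin 2, k)) • (∞ : OnePoint k) = ∞ <;>
      by_cases hi' : (h'.1 : PGL(Fin 2, k)) • (∞ : OnePoint k) = ∞
    · simp only [f, dif_pos hi, dif_pos hi', Sum.inr.injEq] at hhh'
      exact Subtype.ext (congrArg (fun x => ((x.1 : stabilizer H (∞ : OnePoint k)) : H)) hhh')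
    · simp only [f, dif_pos hi, dif_neg hi'] at hhh'
      exact absurd hhh' Sum.inr_ne_inl
    · simp only [f, dif_neg hi, dif_pos hi'] at hhh'
      exact absurd hhh' Sum.inl_ne_inr
    · simp only [f, dif_neg hi, dif_neg hi', Sum.inl.injEq] at hhh'
      exact Subtype.ext (congrArg (fun x => (x.1 : H)) hhh')
  calc Nat.card _ ≤ Nat.card (_ ⊕ _) := Nat.card_le_card_of_injective f hf
    _ = _ := Nat.card_sum
    _ ≤ _ := Nat.add_le_add_left (hN.card_inv_stabilizer_le hp) _

/-! #### Involutions off the stabiliser: the upper bound -/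

open scoped Classical in
omit [Fact (Nat.Prime p)] [CharP k p] hN in
/-- **Involutions off `Stab_H(∞)`, along coset representatives** `σ`: their number is at most
`Σ_c |{n ∈ Stab_H(∞) : (σ(c) n)² = 1}|` over the non-trivial cosets `c` (Faber 2011, §6.2).
[cite: Faber2011, §6.2] -/
theorem card_inv_le_sum_section [Fintype (H ⧸ stabilizer H (∞ : OnePoint k))]
    (σ : H ⧸ stabilizer H (∞ : OnePoint k) → H) (hσ : ∀ c, (σ c : H ⧸ stabilizer H (∞ : OnePoint k)) = c) :
    Nat.card {h : H // (h : PGL(Fin 2, k)) • (∞ : OnePoint k) ≠ ∞ ∧ (h : PGL(Fin 2, k)) ^ 2 = 1} ≤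
      ∑ c ∈ Finset.univ.erase ((1 : H) : H ⧸ stabilizer H (∞ : OnePoint k)),
        Nat.card {n : stabilizer H (∞ : OnePoint k) //
          (((σ c : H) : PGL(Fin 2, k)) * ((n : H) : PGL(Fin 2, k))) ^ 2 = 1} := by
  haveI : Fintype H := Fintype.ofFinite H
  set T := Finset.univ.filter (fun h : H =>
    (h : PGL(Fin 2, k)) • (∞ : OnePoint k) ≠ ∞ ∧ (h : PGL(Fin 2, k)) ^ 2 = 1) with hT
  have hTcard : Nat.card {h : H // (h : PGL(Fin 2, k)) • (∞ : OnePoint k) ≠ ∞ ∧ (h : PGL(Fin 2, k)) ^ 2 = 1}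
      = T.card := by
    rw [Nat.card_eq_fintype_card, Fintype.card_subtype]
  rw [hTcard]
  haveI : Fintype (stabilizer H (∞ : OnePoint k)) := Fintype.ofFinite _
  have hmaps : (↑T : Set H).MapsTo (QuotientGroup.mk : H → H ⧸ stabilizer H (∞ : OnePoint k))
      ↑(Finset.univ.erase ((1 : H) : H ⧸ stabilizer H (∞ : OnePoint k))) := by
    intro h hh
    rw [Finset.mem_coe, hT, Finset.mem_filter] at hh
    rw [Finset.mem_coe, Finset.mem_erase]
    refine ⟨fun heq => hh.2.1 ?_, Finset.mem_univ _⟩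
    rw [QuotientGroup.eq, mul_one] at heq
    have : h ∈ stabilizer H (∞ : OnePoint k) := (inv_mem_iff (x := h)).mp heq
    rwa [mem_stabilizer_iff, Subgroup.smul_def] at this
  rw [Finset.card_eq_sum_card_fiberwise hmaps]
  apply Finset.sum_le_sum
  intro c hc
  set s : H := σ c with hsdef
  have hsc : (s : H ⧸ stabilizer H (∞ : OnePoint k)) = c := hσ c
  let A : Finset (stabilizer H (∞ : OnePoint k)) := Finset.univ.filter
    (fun n => ((s : PGL(Fin 2, k)) * ((n : H) : PGL(Fin 2, k))) ^ 2 = 1)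
  have hA : A.card = Nat.card {n : stabilizer H (∞ : OnePoint k) //
      ((s : PGL(Fin 2, k)) * ((n : H) : PGL(Fin 2, k))) ^ 2 = 1} := by
    rw [Nat.card_eq_fintype_card, Fintype.card_subtype]
  have hsub : T.filter (fun h => (QuotientGroup.mk h : H ⧸ stabilizer H (∞ : OnePoint k)) = c) ⊆
      A.image (fun n : stabilizer H (∞ : OnePoint k) => s * (n : H)) := by
    intro h hh
    rw [Finset.mem_filter, hT, Finset.mem_filter] at hh
    have hm : s⁻¹ * h ∈ stabilizer H (∞ : OnePoint k) := by
      rw [← QuotientGroup.eq]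
      exact hsc.trans hh.2.symm
    rw [Finset.mem_image]
    refine ⟨⟨s⁻¹ * h, hm⟩, ?_, mul_inv_cancel_left s h⟩
    simp only [A, Finset.mem_filter, Finset.mem_univ, true_and]
    rw [Subgroup.coe_mul, Subgroup.coe_inv, mul_inv_cancel_left]
    exact hh.1.2.2
  calc (T.filter (fun h => (QuotientGroup.mk h : H ⧸ stabilizer H (∞ : OnePoint k)) = c)).card
      ≤ (A.image (fun n : stabilizer H (∞ : OnePoint k) => s * (n : H))).card := Finset.card_le_card hsub
    _ ≤ A.card := Finset.card_image_le
    _ = _ := hA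

open scoped Classical in
/-- **Few cosets contain two involutions**: among the non-trivial cosets of `Stab_H(∞)`, at most
`q` contain two or more involutions — such a coset has its point `s • ∞` in `𝔽_q`, and
distinct cosets have distinct points (Faber 2011, Lemma 6.4 and §6.2: "For different choices of
`i`, we get different values of `α_i = s_i.∞`, so that `n ≤ |𝔽_q| = q`").
[cite: Faber2011, Lemma 6.4, §6.2] -/
theorem card_filter_two_le [IsAlgClosed k] [Fintype (H ⧸ stabilizer H (∞ : OnePoint k))]
    (σ : H ⧸ stabilizer H (∞ : OnePoint k) → H) (hσ : ∀ c, (σ c : H ⧸ stabilizer H (∞ : OnePoint k)) = c) :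
    ((Finset.univ.erase ((1 : H) : H ⧸ stabilizer H (∞ : OnePoint k))).filter (fun c =>
      2 ≤ Nat.card {n : stabilizer H (∞ : OnePoint k) //
        (((σ c : H) : PGL(Fin 2, k)) * ((n : H) : PGL(Fin 2, k))) ^ 2 = 1})).card ≤ Nat.card (Gamma H) := by
  haveI := hN.finite_stabField
  haveI : Fintype (stabField (Gamma H)) := Fintype.ofFinite _
  rw [← hN.card_stabField, Nat.card_eq_fintype_card, ← Finset.card_univ]
  set t := Finset.univ.erase ((1 : H) : H ⧸ stabilizer H (∞ : OnePoint k)) with ht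
  -- the rational point of a coset with two involutions
  have hpt : ∀ c ∈ t.filter (fun c => 2 ≤ Nat.card {n : stabilizer H (∞ : OnePoint k) //
      (((σ c : H) : PGL(Fin 2, k)) * ((n : H) : PGL(Fin 2, k))) ^ 2 = 1}),
      ∃ x : stabField (Gamma H), ((σ c : H) : PGL(Fin 2, k)) • (∞ : OnePoint k) = ((x : k) : OnePoint k) := by
    intro c hc
    rw [Finset.mem_filter, ht, Finset.mem_erase] at hc
    obtain ⟨⟨hc1, -⟩, h2⟩ := hc
    have hs : ((σ c : H) : PGL(Fin 2, k)) • (∞ : OnePoint k) ≠ ∞ :=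
      smul_infty_ne_of_mk_ne_one H (by rw [hσ c]; exact hc1)
    have hnt := Finite.one_lt_card_iff_nontrivial.mp (lt_of_lt_of_le one_lt_two h2)
    obtain ⟨⟨n₁, h₁⟩, ⟨n₂, h₂'⟩, hne⟩ := hnt
    obtain ⟨x, hx, hsx⟩ := hN.exists_smul_infty_eq_coe hs (fun h => hne (Subtype.ext h)) h₁ h₂'
    exact ⟨⟨x, hx⟩, hsx⟩
  choose! pt hpt using hpt
  refine Finset.card_le_card_of_injOn pt (fun c _ => Finset.mem_univ _) ?_
  intro c hc c' hc' hcc'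
  have h1 := hpt c hc
  have h2 := hpt c' hc'
  rw [hcc', ← h2] at h1
  -- same point `⇒` same coset
  have hmem : (σ c)⁻¹ * σ c' ∈ stabilizer H (∞ : OnePoint k) := by
    rw [mem_stabilizer_iff, Subgroup.smul_def, Subgroup.coe_mul, Subgroup.coe_inv, mul_smul,
      inv_smul_eq_iff]
    exact h1.symm
  rw [← hσ c, ← hσ c']
  exact QuotientGroup.eq.mpr hmem

/-- **Upper bound for the involutions off `Stab_H(∞)`**: at most `([H : Stab_H(∞)] - 1) + q(q - 2)`
of them, when `d = q - 1` (Faber 2011, §6.2: "`½q(fq-1) ≤ m + n(q-1) … ≤ fq + q(q-2)`").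
[cite: Faber2011, §6.2] -/
theorem card_inv_le [IsAlgClosed k] (hd : Nat.card (Lambda H) = Nat.card (Gamma H) - 1) :
    Nat.card {h : H // (h : PGL(Fin 2, k)) • (∞ : OnePoint k) ≠ ∞ ∧ (h : PGL(Fin 2, k)) ^ 2 = 1} ≤
      ((stabilizer H (∞ : OnePoint k)).index - 1) + Nat.card (Gamma H) * (Nat.card (Gamma H) - 2) := by
  classical
  haveI : Fintype (H ⧸ stabilizer H (∞ : OnePoint k)) := Fintype.ofFinite _
  set q := Nat.card (Gamma H) with hq
  have hq1 : 1 < q := hN.one_lt_card_Gamma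
  set t := Finset.univ.erase ((1 : H) : H ⧸ stabilizer H (∞ : OnePoint k)) with ht
  set J : H ⧸ stabilizer H (∞ : OnePoint k) → ℕ := fun c => Nat.card {n : stabilizer H (∞ : OnePoint k) //
    (((c.out : H) : PGL(Fin 2, k)) * ((n : H) : PGL(Fin 2, k))) ^ 2 = 1} with hJ
  have hup := card_inv_le_sum_section (H := H) Quotient.out (fun c => QuotientGroup.out_eq' c)
  have hJle : ∀ c ∈ t, J c ≤ q - 1 := by
    intro c hc
    rw [← hd]
    refine card_inv_mul_le (H := H) (smul_infty_ne_of_mk_ne_one H ?_)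
    rw [QuotientGroup.out_eq']
    exact (Finset.mem_erase.mp hc).1
  have hA := hN.card_filter_two_le Quotient.out (fun c => QuotientGroup.out_eq' c)
  set A := t.filter (fun c => 2 ≤ J c) with hAdef
  have hsplit := Finset.sum_filter_add_sum_filter_not t (fun c => 2 ≤ J c) J
  have h1 : ∑ c ∈ A, J c ≤ A.card * (q - 1) := by
    rw [mul_comm]
    exact Finset.sum_le_card_nsmul _ _ _ (fun c hc => hJle c (Finset.mem_of_mem_filter c hc)) |>.trans
      (by rw [smul_eq_mul, mul_comm])
  have h2 : ∑ c ∈ t.filter (fun c => ¬ 2 ≤ J c), J c ≤ (t.filter (fun c => ¬ 2 ≤ J c)).card := by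
    calc ∑ c ∈ t.filter (fun c => ¬ 2 ≤ J c), J c ≤ (t.filter (fun c => ¬ 2 ≤ J c)).card • 1 :=
          Finset.sum_le_card_nsmul _ _ _ (fun c hc => by
            have := (Finset.mem_filter.mp hc).2; omega)
      _ = _ := by rw [smul_eq_mul, mul_one]
  have hcardt : A.card + (t.filter (fun c => ¬ 2 ≤ J c)).card = t.card :=
    Finset.card_filter_add_card_filter_not _
  have htcard : t.card = (stabilizer H (∞ : OnePoint k)).index - 1 := by
    rw [ht, Finset.card_erase_of_mem (Finset.mem_univ _), Finset.card_univ, Subgroup.index,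
      ← Nat.card_eq_fintype_card]
  have hAq : A.card ≤ q := hA
  have hmul : A.card * (q - 1) = A.card + A.card * (q - 2) := by
    rw [show q - 1 = (q - 2) + 1 by omega, Nat.mul_add, mul_one, add_comm]
  have hsum : ∑ c ∈ t, J c ≤ t.card + A.card * (q - 2) := by
    calc ∑ c ∈ t, J c = ∑ c ∈ A, J c + ∑ c ∈ t.filter (fun c => ¬ 2 ≤ J c), J c := hsplit.symm
      _ ≤ A.card * (q - 1) + (t.filter (fun c => ¬ 2 ≤ J c)).card := Nat.add_le_add h1 h2
      _ = A.card + A.card * (q - 2) + (t.filter (fun c => ¬ 2 ≤ J c)).card := by rw [hmul]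
      _ = t.card + A.card * (q - 2) := by rw [← hcardt]; ring
  have hmono : A.card * (q - 2) ≤ q * (q - 2) := Nat.mul_le_mul_right _ hAq
  calc _ ≤ ∑ c ∈ t, J c := hup
    _ ≤ _ := by rw [← htcard]; omega

/-! #### Existence of a swap and the value of `f` -/

omit [Fact (Nat.Prime p)] [CharP k p] [Finite H] hN in
/-- `|Stab_H(∞)| = q d`. [cite: Faber2011, Lemma 6.3] -/
theorem card_stabilizer_eq_mul : Nat.card (stabilizer H (∞ : OnePoint k)) = Nat.card (Gamma H) * Nat.card (Lambda H) := by
  rw [card_stabilizer_eq_card_translSubgroup_mul, card_Gamma]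
  rfl

/-- `q = |Γ(H)|` is odd when `p` is odd (it is a power of `p`). [folklore] -/
theorem odd_card_Gamma (hp : p ≠ 2) : Odd (Nat.card (Gamma H)) := by
  obtain ⟨P, -, hPi⟩ := hN.exists_sylow
  rw [card_Gamma_eq_card_sylow p H P hPi, Sylow.card_eq_multiplicity]
  exact Odd.pow ((Fact.out : p.Prime).odd_of_ne_two hp)

/-- The centraliser of `t₀` in `H`, counted on `H`. [folklore] -/
theorem card_comm_eq [IsAlgClosed k] (hd : Nat.card (Lambda H) = Nat.card (Gamma H) - 1) :
    Nat.card {g : H // g * ⟨homoth (-1 : kˣ), hN.homoth_neg_one_mem hd⟩ =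
        ⟨homoth (-1 : kˣ), hN.homoth_neg_one_mem hd⟩ * g} =
      Nat.card {g : H // (g : PGL(Fin 2, k)) * homoth (-1 : kˣ) = homoth (-1 : kˣ) * g} := by
  refine Nat.card_congr (Equiv.subtypeEquivRight fun g => ?_)
  rw [Subtype.ext_iff, Subgroup.coe_mul, Subgroup.coe_mul]

/-- **There is an element of `H` swapping `0` and `∞`** (`p` odd, `d = q - 1`): otherwise the
centraliser of `t₀` has at most `q - 1` elements, `t₀` has at least `q n` conjugates, and the
involutions off `Stab_H(∞)` would be too many (Faber 2011, §6.2: "`fq² ≤ … ≤ fq(q-1)`, which is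
absurd. We conclude that `t₀` is normalized by the dihedral group `D`").
[cite: Faber2011, §6.2] -/
theorem exists_swap [IsAlgClosed k] (hp : p ≠ 2) (hd : Nat.card (Lambda H) = Nat.card (Gamma H) - 1) :
    ∃ w ∈ H, w • (∞ : OnePoint k) = ((0 : k) : OnePoint k) ∧ w • ((0 : k) : OnePoint k) = ∞ := by
  by_contra hsw
  push Not at hsw
  set q := Nat.card (Gamma H) with hq
  set n := (stabilizer H (∞ : OnePoint k)).index with hn
  have hq1 : 1 < q := hN.one_lt_card_Gamma
  -- `q n ≤ #conjugates`
  have hoc := card_conj_mul_card_comm (⟨homoth (-1 : kˣ), hN.homoth_neg_one_mem hd⟩ : H)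
  rw [hN.card_comm_eq hd, ← Subgroup.card_mul_index (stabilizer H (∞ : OnePoint k)),
    card_stabilizer_eq_mul, hd] at hoc
  have hz := card_comm_le_of_forall (H := H) hp (fun w hw => hsw w w.2 hw.1 hw.2)
  rw [hd] at hz
  have hz1 : 1 ≤ Nat.card {g : H // (g : PGL(Fin 2, k)) * homoth (-1 : kˣ) = homoth (-1 : kˣ) * g} := by
    haveI : Finite {g : H // (g : PGL(Fin 2, k)) * homoth (-1 : kˣ) = homoth (-1 : kˣ) * g} := inferInstance
    have : Nonempty {g : H // (g : PGL(Fin 2, k)) * homoth (-1 : kˣ) = homoth (-1 : kˣ) * g} :=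
      ⟨⟨1, by rw [Subgroup.coe_one, one_mul, mul_one]⟩⟩
    exact Nat.card_pos
  set C := Nat.card {h : H // ∃ g : H, g * ⟨homoth (-1 : kˣ), hN.homoth_neg_one_mem hd⟩ * g⁻¹ = h} with hC
  set z := Nat.card {g : H // (g : PGL(Fin 2, k)) * homoth (-1 : kˣ) = homoth (-1 : kˣ) * g} with hzdef
  have hCge : q * n ≤ C := by
    -- `C z = q (q-1) n` with `1 ≤ z ≤ q - 1`
    have h1 : C * z ≤ C * (q - 1) := Nat.mul_le_mul_left C hz
    rw [hoc] at h1
    have h2 : q * (q - 1) * n = (q * n) * (q - 1) := by ring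
    rw [h2] at h1
    exact Nat.le_of_mul_le_mul_right h1 (by omega)
  have hCle := hN.card_conj_le hp hd
  have hInv := hN.card_inv_le hd
  -- `q ≤ n - 1` since `q ∣ n - 1` and `n > 1`
  have hlt : 1 < n := Subgroup.one_lt_index_of_ne_top hN.stabilizer_ne_top
  obtain ⟨P, hP1, hPi⟩ := hN.exists_sylow
  have hdvd := card_sylow_dvd_index_stabilizer_sub_one p H P hPi
  rw [card_Gamma_eq_card_sylow p H P hPi |>.symm] at hdvd
  have hqn : q ≤ n - 1 := Nat.le_of_dvd (by omega) hdvd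
  -- combine: `q n ≤ C ≤ Inv + q ≤ (n - 1) + q (q - 2) + q`
  have key : q * n ≤ (n - 1) + q * (q - 2) + q := hCge.trans (hCle.trans (Nat.add_le_add_right hInv _))
  have hq2 : 2 ≤ q := hq1
  have hn1 : 1 ≤ n := hlt.le
  zify [hn1, hq2] at key hqn
  nlinarith [mul_nonneg (sub_nonneg.mpr hqn) (by linarith : (0 : ℤ) ≤ (q : ℤ) - 1)]

omit [Finite H] hN in
/-- A swap of `0, ∞` commutes with `t₀ = δ_{-1}` (it is an antidiagonal involution `w_b`, and
`w_b δ_{-1} w_b = δ_{-1}`). [cite: Faber2011, §4.3, §6.2] -/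
theorem swap_mul_homoth_neg_one {w : PGL(Fin 2, k)}
    (hw : w • (∞ : OnePoint k) = ((0 : k) : OnePoint k) ∧ w • ((0 : k) : OnePoint k) = ∞) :
    w * homoth (-1 : kˣ) = homoth (-1 : kˣ) * w := by
  obtain ⟨b, rfl⟩ := exists_eq_antidiag_of_smul_infty_of_smul_zero hw.1 hw.2
  have h := antidiag_mul_homoth_mul_antidiag b (-1 : kˣ)
  rw [inv_neg, inv_one] at h
  calc antidiag b * homoth (-1 : kˣ) = antidiag b * homoth (-1 : kˣ) * antidiag b * antidiag b := by
        rw [mul_assoc, antidiag_mul_self, mul_one]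
    _ = homoth (-1 : kˣ) * antidiag b := by rw [h]

omit [Fact (Nat.Prime p)] [CharP k p] in
/-- **With a swap, the centraliser of `t₀` has at least `2(q-1)` elements**: the homotheties
`δ_a` and the `w δ_a`, `a ∈ Λ` (Faber 2011, §6.2: the dihedral group `D = H ⋊ ⟨(0 τ; 1 0)⟩`).
[cite: Faber2011, §6.2] -/
theorem two_mul_card_Lambda_le_card_comm {w : PGL(Fin 2, k)} (hwH : w ∈ H)
    (hw : w • (∞ : OnePoint k) = ((0 : k) : OnePoint k) ∧ w • ((0 : k) : OnePoint k) = ∞) :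
    2 * Nat.card (Lambda H) ≤
      Nat.card {g : H // (g : PGL(Fin 2, k)) * homoth (-1 : kˣ) = homoth (-1 : kˣ) * g} := by
  classical
  have hwc := swap_mul_homoth_neg_one hw
  have hcomm : ∀ a : kˣ, homoth a * homoth (-1 : kˣ) = homoth (-1 : kˣ) * homoth a := fun a => by
    rw [← map_mul, ← map_mul, mul_comm]
  let f : Lambda H ⊕ Lambda H → {g : H // (g : PGL(Fin 2, k)) * homoth (-1 : kˣ) = homoth (-1 : kˣ) * g} :=
    fun x => match x with
    | Sum.inl a => ⟨⟨homoth (a : kˣ), hN.homoth_mem _ a.2⟩, hcomm a⟩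
    | Sum.inr a => ⟨⟨w * homoth (a : kˣ), mul_mem hwH (hN.homoth_mem _ a.2)⟩, by
        change w * homoth (a : kˣ) * homoth (-1 : kˣ) = homoth (-1 : kˣ) * (w * homoth (a : kˣ))
        rw [mul_assoc, hcomm, ← mul_assoc, hwc, mul_assoc]⟩
  have hf : Function.Injective f := by
    rintro (a | a) (b | b) hab
    · have := congrArg (fun x => ((x.1 : H) : PGL(Fin 2, k))) hab
      exact congrArg Sum.inl (Subtype.ext (homoth_injective this))
    · have := congrArg (fun x => ((x.1 : H) : PGL(Fin 2, k)) • (∞ : OnePoint k)) hab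
      simp only [f, homoth_smul_infty, mul_smul, hw.1] at this
      exact absurd this (OnePoint.infty_ne_coe 0)
    · have := congrArg (fun x => ((x.1 : H) : PGL(Fin 2, k)) • (∞ : OnePoint k)) hab
      simp only [f, homoth_smul_infty, mul_smul, hw.1] at this
      exact absurd this (OnePoint.coe_ne_infty 0)
    · have := congrArg (fun x => ((x.1 : H) : PGL(Fin 2, k))) hab
      exact congrArg Sum.inr (Subtype.ext (homoth_injective (mul_left_cancel this)))
  haveI : Finite (Lambda H) := Finite.of_surjective _ (stabDeriv H).rangeRestrict_surjective
  calc 2 * Nat.card (Lambda H) = Nat.card (Lambda H ⊕ Lambda H) := by rw [Nat.card_sum]; ring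
    _ ≤ _ := Nat.card_le_card_of_injective f hf

/-- **`2 · #conjugates(t₀) = q n`** (`n = [H : Stab_H(∞)]`): the centraliser of `t₀` has exactly
`2(q - 1)` elements (Faber 2011, §6.2: "the number of elements in `G ∖ D` conjugate to `t₀` is
precisely `½ q(1+fq) - q`"). [cite: Faber2011, §6.2] -/
theorem two_mul_card_conj_eq [IsAlgClosed k] (hp : p ≠ 2) (hd : Nat.card (Lambda H) = Nat.card (Gamma H) - 1) :
    2 * Nat.card {h : H // ∃ g : H, g * ⟨homoth (-1 : kˣ), hN.homoth_neg_one_mem hd⟩ * g⁻¹ = h} =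
      Nat.card (Gamma H) * (stabilizer H (∞ : OnePoint k)).index := by
  obtain ⟨w, hwH, hw⟩ := hN.exists_swap hp hd
  have hz : Nat.card {g : H // (g : PGL(Fin 2, k)) * homoth (-1 : kˣ) = homoth (-1 : kˣ) * g} =
      2 * Nat.card (Lambda H) :=
    le_antisymm (card_comm_le (H := H) hp) (hN.two_mul_card_Lambda_le_card_comm hwH hw)
  have hoc := card_conj_mul_card_comm (⟨homoth (-1 : kˣ), hN.homoth_neg_one_mem hd⟩ : H)
  rw [hN.card_comm_eq hd, hz, ← Subgroup.card_mul_index (stabilizer H (∞ : OnePoint k)),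
    card_stabilizer_eq_mul] at hoc
  have hq1 : 1 < Nat.card (Gamma H) := hN.one_lt_card_Gamma
  have hd0 : 0 < Nat.card (Lambda H) := by rw [hd]; omega
  -- cancel `|Λ|`
  have : (2 * Nat.card {h : H // ∃ g : H, g * ⟨homoth (-1 : kˣ), hN.homoth_neg_one_mem hd⟩ * g⁻¹ = h}) *
      Nat.card (Lambda H) = (Nat.card (Gamma H) * (stabilizer H (∞ : OnePoint k)).index) * Nat.card (Lambda H) := by
    calc (2 * Nat.card {h : H // ∃ g : H, g * ⟨homoth (-1 : kˣ), hN.homoth_neg_one_mem hd⟩ * g⁻¹ = h}) *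
          Nat.card (Lambda H)
        = Nat.card {h : H // ∃ g : H, g * ⟨homoth (-1 : kˣ), hN.homoth_neg_one_mem hd⟩ * g⁻¹ = h} *
          (2 * Nat.card (Lambda H)) := by ring
      _ = _ := hoc
      _ = _ := by ring
  exact Nat.eq_of_mul_eq_mul_right hd0 this

omit hN in
/-- The elementary inequality of Faber 2011, §6.2: for `q ≥ 3`, `f` odd and
`q(qf+1) ≤ 2qf + 2q(q-2) + 2q` (i.e. `f(q-2) ≤ 2q - 3`), either `f = 1`, or `f = 3` and `q = 3`
("`f ≤ 2 + 1/(q-2)`. Since `f` is odd, we find `f = 1`, or `f = 3` and `q = 3`").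
[cite: Faber2011, §6.2] -/
theorem eq_one_or_of_odd_of_le {q f : ℕ} (hq3 : 3 ≤ q) (hf : Odd f)
    (hineq : q * (q * f + 1) ≤ 2 * (q * f) + 2 * q * (q - 2) + 2 * q) : f = 1 ∨ (f = 3 ∧ q = 3) := by
  obtain ⟨m, rfl⟩ := hf
  have hq2 : 2 ≤ q := by omega
  have hq0 : (0 : ℤ) < q := by exact_mod_cast (show 0 < q by omega)
  have hq3' : (3 : ℤ) ≤ q := by exact_mod_cast hq3
  zify [hq2] at hineq
  rcases Nat.lt_or_ge m 2 with hm | hm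
  · interval_cases m
    · left; rfl
    · right
      refine ⟨rfl, ?_⟩
      norm_num at hineq
      have : (q : ℤ) ≤ 3 := by nlinarith [mul_pos hq0 hq0]
      have : q ≤ 3 := by exact_mod_cast this
      omega
  · exfalso
    have hm' : (2 : ℤ) ≤ m := by exact_mod_cast hm
    nlinarith [mul_le_mul_of_nonneg_left hm' (by linarith : (0:ℤ) ≤ (q:ℤ) - 2),
      mul_le_mul_of_nonneg_right hq3' (by linarith : (0:ℤ) ≤ (m:ℤ)), mul_pos hq0 hq0]

/-- **Faber 2011, §6.2: `f = 1`, or `f = 3` and `q = 3`.** For `k` algebraically closed of odd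
characteristic `p` and `H ≤ PGL₂(k)` finite in normal form with `|Λ| = q - 1`, the number
`n = [H : Stab_H(∞)] = 1 + fq` of Sylow `p`-subgroups is `q + 1`, or `q = 3` and `n = 10`.
[cite: Faber2011, §6.2] -/
theorem index_eq_or [IsAlgClosed k] (hp : p ≠ 2) (hd : Nat.card (Lambda H) = Nat.card (Gamma H) - 1) :
    (stabilizer H (∞ : OnePoint k)).index = Nat.card (Gamma H) + 1 ∨
      ((stabilizer H (∞ : OnePoint k)).index = 10 ∧ Nat.card (Gamma H) = 3) := by
  have h2C := hN.two_mul_card_conj_eq hp hd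
  have hCle := hN.card_conj_le hp hd
  have hInv := hN.card_inv_le hd
  have hodd := hN.odd_card_Gamma hp
  have hq1 : 1 < Nat.card (Gamma H) := hN.one_lt_card_Gamma
  have hq3 : 3 ≤ Nat.card (Gamma H) := by
    obtain ⟨r, hr⟩ := hodd
    omega
  have hlt : 1 < (stabilizer H (∞ : OnePoint k)).index := Subgroup.one_lt_index_of_ne_top hN.stabilizer_ne_top
  obtain ⟨P, hP1, hPi⟩ := hN.exists_sylow
  have hdvd := card_sylow_dvd_index_stabilizer_sub_one p H P hPi
  rw [card_Gamma_eq_card_sylow p H P hPi |>.symm] at hdvd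
  obtain ⟨f, hf⟩ := hdvd
  have hnf : (stabilizer H (∞ : OnePoint k)).index = Nat.card (Gamma H) * f + 1 := by omega
  -- `n` is even, so `f` is odd
  have hneven : Even ((stabilizer H (∞ : OnePoint k)).index) := by
    have : Even (Nat.card (Gamma H) * (stabilizer H (∞ : OnePoint k)).index) := ⟨_, by rw [← h2C, two_mul]⟩
    exact (Nat.even_mul.mp this).resolve_left (Nat.not_even_iff_odd.mpr hodd)
  have hfodd : Odd f := by
    have : Odd (Nat.card (Gamma H) * f) := by
      rw [hnf] at hneven
      exact Nat.not_even_iff_odd.mp (Nat.even_add_one.mp hneven)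
    exact (Nat.odd_mul.mp this).2
  -- the inequality `q n ≤ 2 (n-1) + 2 q (q-2) + 2 q`
  have hineq : Nat.card (Gamma H) * (Nat.card (Gamma H) * f + 1) ≤
      2 * (Nat.card (Gamma H) * f) + 2 * Nat.card (Gamma H) * (Nat.card (Gamma H) - 2) + 2 * Nat.card (Gamma H) := by
    have : Nat.card (Gamma H) * (stabilizer H (∞ : OnePoint k)).index ≤
        2 * (((stabilizer H (∞ : OnePoint k)).index - 1) + Nat.card (Gamma H) * (Nat.card (Gamma H) - 2)) +
          2 * Nat.card (Gamma H) := by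
      calc Nat.card (Gamma H) * (stabilizer H (∞ : OnePoint k)).index
          = 2 * Nat.card {h : H // ∃ g : H, g * ⟨homoth (-1 : kˣ), hN.homoth_neg_one_mem hd⟩ * g⁻¹ = h} := h2C.symm
        _ ≤ 2 * (Nat.card {h : H // (h : PGL(Fin 2, k)) • (∞ : OnePoint k) ≠ ∞ ∧ (h : PGL(Fin 2, k)) ^ 2 = 1} +
            Nat.card (Gamma H)) := Nat.mul_le_mul_left 2 hCle
        _ ≤ 2 * (((stabilizer H (∞ : OnePoint k)).index - 1) + Nat.card (Gamma H) * (Nat.card (Gamma H) - 2) +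
            Nat.card (Gamma H)) := Nat.mul_le_mul_left 2 (Nat.add_le_add_right hInv _)
        _ = _ := by ring
    rw [hnf, Nat.add_sub_cancel] at this
    linarith
  rcases eq_one_or_of_odd_of_le hq3 hfodd hineq with h1 | ⟨h3, hq3'⟩
  · left
    rw [hnf, h1, mul_one]
  · right
    exact ⟨by rw [hnf, h3, hq3'], hq3'⟩

/-! #### `f = 1`: `H = PGL₂(𝔽_q)` -/

omit [Fact (Nat.Prime p)] [CharP k p] [Finite H] hN in
/-- The conjugates `v_μ = τ_μ w τ_{-μ}` of a swap `w`: `v_μ ∈ H` moves `∞` to `μ`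
(Faber 2011, §6.2.1: "`v_μ := (1 μ; 0 1)(0 τ; 1 0)(1 -μ; 0 1) = (μ τ-μ²; 1 -μ)` …
satisfying `v_μ.∞ = μ`"). [cite: Faber2011, §6.2.1] -/
theorem conj_swap_smul_infty {w : PGL(Fin 2, k)}
    (hw : w • (∞ : OnePoint k) = ((0 : k) : OnePoint k) ∧ w • ((0 : k) : OnePoint k) = ∞) (μ : k) :
    (transl μ * w * transl (-μ)) • (∞ : OnePoint k) = ((μ : k) : OnePoint k) := by
  rw [mul_smul, mul_smul, transl_smul_infty, hw.1, transl_smul_coe, zero_add]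

/-- **`f = 1`: every element of `H` moves `∞` into `ℙ¹(𝔽_q)`** — the `q` elements `v_μ`,
`μ ∈ 𝔽_q`, occupy the `q` non-trivial cosets of `Stab_H(∞)` (Faber 2011, §6.2.1: "each `v_μ` must
lie in a distinct nontrivial coset `s_i N`. There are only `fq = q` such cosets").
[cite: Faber2011, §6.2.1] -/
theorem exists_eq_conj_swap_mul [IsAlgClosed k] {w : PGL(Fin 2, k)} (hwH : w ∈ H)
    (hw : w • (∞ : OnePoint k) = ((0 : k) : OnePoint k) ∧ w • ((0 : k) : OnePoint k) = ∞)
    (hn : (stabilizer H (∞ : OnePoint k)).index = Nat.card (Gamma H) + 1) {h : PGL(Fin 2, k)} (hh : h ∈ H)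
    (hhi : h • (∞ : OnePoint k) ≠ ∞) :
    ∃ μ ∈ stabField (Gamma H), ∃ n ∈ H, n • (∞ : OnePoint k) = ∞ ∧ h = transl μ * w * transl (-μ) * n := by
  classical
  haveI := hN.finite_stabField
  haveI : Fintype (H ⧸ stabilizer H (∞ : OnePoint k)) := Fintype.ofFinite _
  have hv : ∀ μ : stabField (Gamma H), transl (μ : k) * w * transl (-(μ : k)) ∈ H := fun μ =>
    mul_mem (mul_mem (hN.transl_mem μ.2) hwH) (hN.transl_mem (neg_mem μ.2))
  have hvS : ∀ μ : stabField (Gamma H), (((⟨_, hv μ⟩ : H)) : H ⧸ stabilizer H (∞ : OnePoint k)) ≠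
      ((1 : H) : H ⧸ stabilizer H (∞ : OnePoint k)) := by
    intro μ heq
    rw [QuotientGroup.eq, mul_one] at heq
    have : (⟨_, hv μ⟩ : H) ∈ stabilizer H (∞ : OnePoint k) := (inv_mem_iff (x := (⟨_, hv μ⟩ : H))).mp heq
    rw [mem_stabilizer_iff, Subgroup.smul_def] at this
    change (transl (μ : k) * w * transl (-(μ : k))) • (∞ : OnePoint k) = ∞ at this
    rw [conj_swap_smul_infty hw] at this
    exact OnePoint.coe_ne_infty _ this
  -- `μ ↦ coset of v_μ`, into the non-trivial cosets
  let φ : stabField (Gamma H) → {c : H ⧸ stabilizer H (∞ : OnePoint k) //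
      c ≠ ((1 : H) : H ⧸ stabilizer H (∞ : OnePoint k))} := fun μ => ⟨_, hvS μ⟩
  have hφ : Function.Injective φ := by
    intro μ μ' hμμ'
    have heq : (((⟨_, hv μ⟩ : H)) : H ⧸ stabilizer H (∞ : OnePoint k)) = ((⟨_, hv μ'⟩ : H) : H ⧸ _) :=
      congrArg Subtype.val hμμ'
    rw [QuotientGroup.eq, mem_stabilizer_iff, Subgroup.smul_def, Subgroup.coe_mul, Subgroup.coe_inv, mul_smul,
      inv_smul_eq_iff] at heq
    change (transl (μ' : k) * w * transl (-(μ' : k))) • (∞ : OnePoint k) =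
      (transl (μ : k) * w * transl (-(μ : k))) • (∞ : OnePoint k) at heq
    rw [conj_swap_smul_infty hw, conj_swap_smul_infty hw, OnePoint.coe_eq_coe] at heq
    exact Subtype.ext heq.symm
  -- both sides have `q` elements, so `φ` is onto
  have hcard : Nat.card (stabField (Gamma H)) = Nat.card {c : H ⧸ stabilizer H (∞ : OnePoint k) //
      c ≠ ((1 : H) : H ⧸ stabilizer H (∞ : OnePoint k))} := by
    have h1 := Nat.card_congr (Equiv.optionSubtypeNe ((1 : H) : H ⧸ stabilizer H (∞ : OnePoint k)))
    rw [Finite.card_option] at h1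
    have h2 : Nat.card (H ⧸ stabilizer H (∞ : OnePoint k)) = Nat.card (Gamma H) + 1 := hn
    rw [hN.card_stabField]
    omega
  have hbij : Function.Bijective φ := (Nat.bijective_iff_injective_and_card φ).mpr ⟨hφ, hcard⟩
  -- the coset of `h`
  have hhS : ((⟨h, hh⟩ : H) : H ⧸ stabilizer H (∞ : OnePoint k)) ≠ ((1 : H) : H ⧸ stabilizer H (∞ : OnePoint k)) := by
    intro heq
    rw [QuotientGroup.eq, mul_one] at heq
    have : (⟨h, hh⟩ : H) ∈ stabilizer H (∞ : OnePoint k) := (inv_mem_iff (x := (⟨h, hh⟩ : H))).mp heq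
    rw [mem_stabilizer_iff, Subgroup.smul_def] at this
    exact hhi this
  obtain ⟨μ, hμ⟩ := hbij.2 ⟨_, hhS⟩
  have heq : (((⟨_, hv μ⟩ : H)) : H ⧸ stabilizer H (∞ : OnePoint k)) = ((⟨h, hh⟩ : H) : H ⧸ _) :=
    congrArg Subtype.val hμ
  rw [QuotientGroup.eq] at heq
  refine ⟨μ, μ.2, (transl (μ : k) * w * transl (-(μ : k)))⁻¹ * h, ?_, ?_, ?_⟩
  · have := ((⟨_, hv μ⟩ : H)⁻¹ * ⟨h, hh⟩ : H).2
    rwa [Subgroup.coe_mul, Subgroup.coe_inv] at this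
  · have := heq
    rw [mem_stabilizer_iff, Subgroup.smul_def, Subgroup.coe_mul, Subgroup.coe_inv] at this
    exact this
  · rw [mul_inv_cancel_left]

/-- The swap is an antidiagonal `w_b` with `b ∈ 𝔽_q` (`f = 1`): `b = (w τ_1 w) • ∞ ∈ ℙ¹(𝔽_q)`.
[cite: Faber2011, §6.2.1] -/
theorem exists_eq_antidiag_of_index_eq [IsAlgClosed k] {w : PGL(Fin 2, k)} (hwH : w ∈ H)
    (hw : w • (∞ : OnePoint k) = ((0 : k) : OnePoint k) ∧ w • ((0 : k) : OnePoint k) = ∞)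
    (hn : (stabilizer H (∞ : OnePoint k)).index = Nat.card (Gamma H) + 1) :
    ∃ b ∈ stabField (Gamma H), ∃ hb : b ≠ 0, w = antidiag (Units.mk0 b hb) := by
  obtain ⟨b, rfl⟩ := exists_eq_antidiag_of_smul_infty_of_smul_zero hw.1 hw.2
  -- `g = w τ_1 w ∈ H` moves `∞` to `b`
  have hg : (antidiag b * transl 1 * antidiag b) • (∞ : OnePoint k) = ((b : k) : OnePoint k) := by
    rw [mul_smul, mul_smul, antidiag_smul_infty, transl_smul_coe, zero_add, antidiag_smul_coe b one_ne_zero, div_one]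
  have hgH : antidiag b * transl 1 * antidiag b ∈ H :=
    mul_mem (mul_mem hwH (hN.transl_mem (stabField (Gamma H)).one_mem)) hwH
  obtain ⟨μ, hμ, n, -, hni, hgeq⟩ := hN.exists_eq_conj_swap_mul hwH hw hn hgH
    (by rw [hg]; exact OnePoint.coe_ne_infty _)
  have : ((b : k) : OnePoint k) = ((μ : k) : OnePoint k) := by
    rw [← hg, hgeq, mul_smul, hni, conj_swap_smul_infty hw]
  rw [OnePoint.coe_eq_coe] at this
  refine ⟨(b : k), this ▸ hμ, b.ne_zero, ?_⟩
  congr 1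
  exact Units.ext rfl

omit [DecidableEq k] [Fact (Nat.Prime p)] [CharP k p] [Finite H] hN in
/-- `v_μ = τ_μ w_b τ_{-μ}` lies in `PGL₂(𝔽_q)` for `μ, b ∈ 𝔽_q`: its lift is `(μ, b - μ²; 1, -μ)`.
[cite: Faber2011, §6.2.1] -/
theorem conj_antidiag_mem_pglTwo {F : Subfield k} {μ b : k} (hμ : μ ∈ F) (hbF : b ∈ F) (hb : b ≠ 0) :
    transl μ * antidiag (Units.mk0 b hb) * transl (-μ) ∈ pglTwo F := by
  refine mul_mem (mul_mem (pslTwo_le_pglTwo F (transl_mem_pslTwo F hμ)) ?_)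
    (pslTwo_le_pglTwo F (transl_mem_pslTwo F (F.neg_mem hμ)))
  rw [antidiag]
  refine mk_mem_pglTwo_of_forall_mem F (fun i j => ?_)
  fin_cases i <;> fin_cases j <;> simp [Matrix.GeneralLinearGroup.mkOfDetNeZero, hbF, F.one_mem, F.zero_mem]

/-- **`f = 1` ⇒ `H ≤ PGL₂(𝔽_q)`**: the stabiliser consists of `τ_μ δ_a` (`μ ∈ 𝔽_q`, `a ∈ 𝔽_qˣ`)
and every other coset is `v_μ Stab_H(∞)` (Faber 2011, §6.2.1: "We have now shown that
`N ⊂ PGL₂(𝔽_q)`, and that each nontrivial coset representative may be chosen … which proves that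
`G ⊂ PGL₂(𝔽_q)`"). [cite: Faber2011, §6.2.1] -/
theorem le_pglTwo_of_index_eq [IsAlgClosed k] (hp : p ≠ 2) (hd : Nat.card (Lambda H) = Nat.card (Gamma H) - 1)
    (hn : (stabilizer H (∞ : OnePoint k)).index = Nat.card (Gamma H) + 1) :
    H ≤ pglTwo (stabField (Gamma H)) := by
  obtain ⟨w, hwH, hw⟩ := hN.exists_swap hp hd
  obtain ⟨b, hbF, hb0, rfl⟩ := hN.exists_eq_antidiag_of_index_eq hwH hw hn
  -- elements fixing `∞`
  have hstab : ∀ n ∈ H, n • (∞ : OnePoint k) = ∞ → n ∈ pglTwo (stabField (Gamma H)) := by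
    intro n hnH hni
    set n' : stabilizer H (∞ : OnePoint k) := ⟨⟨n, hnH⟩, by rw [mem_stabilizer_iff, Subgroup.smul_def]; exact hni⟩
    have hdec := coe_stabilizer_eq_transl_mul_homoth n'
    change n = _ at hdec
    rw [hdec]
    refine mul_mem (pslTwo_le_pglTwo _ (transl_mem_pslTwo _ (hN.shiftInfty_mem n'))) ?_
    have ha : ((stabDeriv H n' : kˣ) : k) ∈ stabField (Gamma H) := coe_mem_stabField_of_mem_Lambda ⟨n', rfl⟩
    have : (stabDeriv H n' : kˣ) = Units.mk0 ((stabDeriv H n' : kˣ) : k) (stabDeriv H n' : kˣ).ne_zero :=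
      Units.ext rfl
    rw [this]
    exact homoth_mem_pglTwo _ ha _
  intro h hh
  by_cases hhi : h • (∞ : OnePoint k) = ∞
  · exact hstab h hh hhi
  · obtain ⟨μ, hμ, n, hnH, hni, rfl⟩ := hN.exists_eq_conj_swap_mul hwH hw hn hh hhi
    exact mul_mem (conj_antidiag_mem_pglTwo hμ hbF hb0) (hstab n hnH hni)

/-- **Faber 2011, §6.2.1: `f = 1` ⇒ `H = PGL₂(𝔽_q)`.** For `k` algebraically closed of odd
characteristic `p` and `H ≤ PGL₂(k)` finite in normal form with `|Λ| = q - 1` and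
`[H : Stab_H(∞)] = q + 1`, `H` is the image of `PGL₂(𝔽_q)`, `𝔽_q = 𝔽_{Γ(H)} ≤ k`
("Here we have `|G| = |Λ|(1 + fq)q = q(q² - 1) = |PGL₂(𝔽_q)|`. We now prove that `G ⊂ PGL₂(𝔽_q)`,
so that this containment must actually be equality"). [cite: Faber2011, Thm. 6.1, §6.2.1] -/
theorem eq_pglTwo [IsAlgClosed k] (hp : p ≠ 2) (hd : Nat.card (Lambda H) = Nat.card (Gamma H) - 1)
    (hn : (stabilizer H (∞ : OnePoint k)).index = Nat.card (Gamma H) + 1) :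
    H = pglTwo (stabField (Gamma H)) := by
  classical
  haveI := hN.finite_stabField
  haveI : Fintype (stabField (Gamma H)) := Fintype.ofFinite _
  haveI : Finite (GL (Fin 2) (stabField (Gamma H))) := inferInstance
  haveI : Finite PGL(Fin 2, stabField (Gamma H)) :=
    Finite.of_surjective _ Matrix.ProjGenLinGroup.mk_surjective
  haveI : Finite (pglTwo (stabField (Gamma H))) :=
    Finite.of_surjective _ (MonoidHom.rangeRestrict_surjective _)
  refine Subgroup.eq_of_le_of_card_ge (hN.le_pglTwo_of_index_eq hp hd hn) ?_
  rw [card_pglTwo, hN.card_stabField, ← Subgroup.card_mul_index (stabilizer H (∞ : OnePoint k)),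
    card_stabilizer_eq_mul, hd, hn]
  have hq1 : 1 < Nat.card (Gamma H) := hN.one_lt_card_Gamma
  have hsq : Nat.card (Gamma H) ^ 2 - 1 = (Nat.card (Gamma H) + 1) * (Nat.card (Gamma H) - 1) := by
    simpa using Nat.sq_sub_sq (Nat.card (Gamma H)) 1
  rw [hsq]
  exact le_of_eq (by ring)

omit [Fact (Nat.Prime p)] [CharP k p] [Finite H] hN in
/-- **The exceptional case `(f, q) = (3, 3)` has `|H| = 60`** (Faber 2011, §6.2.2:
"`|G| = |Λ|(1 + fq)q = 60`"; the identification with `𝔄₅` is not made here).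
[cite: Faber2011, §6.2.2] -/
theorem card_eq_sixty [IsAlgClosed k] (hd : Nat.card (Lambda H) = Nat.card (Gamma H) - 1)
    (hn : (stabilizer H (∞ : OnePoint k)).index = 10) (hq : Nat.card (Gamma H) = 3) : Nat.card H = 60 := by
  rw [← Subgroup.card_mul_index (stabilizer H (∞ : OnePoint k)), card_stabilizer_eq_mul, hd, hn, hq]

/-- **Faber 2011, §6.2 (summary).** For `k` algebraically closed of odd characteristic `p` and
`H ≤ PGL₂(k)` finite in normal form with `|Λ| = q - 1`: either `H = PGL₂(𝔽_q)` for the subfield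
`𝔽_q = 𝔽_{Γ(H)}` of `k`, or `q = 3` and `|H| = 60` (the icosahedral case of §6.2.2).
[cite: Faber2011, Thm. 6.1, §6.2] -/
theorem eq_pglTwo_or_card_eq_sixty [IsAlgClosed k] (hp : p ≠ 2)
    (hd : Nat.card (Lambda H) = Nat.card (Gamma H) - 1) :
    H = pglTwo (stabField (Gamma H)) ∨ (Nat.card (Gamma H) = 3 ∧ Nat.card H = 60) := by
  rcases hN.index_eq_or hp hd with hn | ⟨hn, hq⟩
  · exact Or.inl (hN.eq_pglTwo hp hd hn)
  · exact Or.inr ⟨hq, card_eq_sixty hd hn hq⟩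

end IsNormalised

end CaseAll

end Literature.GroupTheory.SpecificGroups.PGL2
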